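import Summits.QuantumFields.YangMills.Theorems.ColdStartUniversalityLatticeLangevinWilsonLogSobolevIffEntropyDecay
import Literature.MathematicalPhysics.QuantumFieldTheory.Balaban1983to89.T3ContinuumYM3Torus
import HarnessLib

/-!
# Route `ColdStartUniversality`, aside K_A1 `UniformColdStartMixing` (24809), LINE 4 «cold_entropy» — (ULS) ⟺ (UED): the K-uniform
# log-Sobolev inequality in physical units IS K-uniform exponential decay of entropy in physical time

Helper file (seat `ym-line-csu-p1`, g22; `--supports stmt-QuantumFields-24809`).  (ULS) — the named input of the registered XL stub
`stub_entropyDissipation` (g21 `stub_entropyDissipation_of_uniformLogSobolev`) — is the K-UNIFORM generator-form log-Sobolev inequality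
`c·ε_K·Ent_{μ_K}(F²) ≤ −∫ F 𝓛_K f dμ_K` (`μ_K` the Wilson measure at the SZZ coupling `β'_K = (γε_K)⁻¹/2` on `L_K = (F.P K).sitesPerDir 0`).
By the fixed-cut-off equivalence `generatorLogSobolev_iff_entropy_decay` (BGL Thm 5.2.1, g21 + g22) it is EQUIVALENT to

  (UED)  `∃ γ₁ > 0 ∀ F γ (0 < γ ≤ γ₁) ∃ c > 0 ∃ K₀ ∀ K ≥ K₀`, for every Markov kernel family realising the SZZ transition laws at cut-off
         `K`, every positive `C³` compactly supported cylinder density `Q` and every lattice time `t`: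
         `Ent_{μ_K}(κ_t Q) ≤ exp(−4c·(ε_K t))·Ent_{μ_K}(Q)` — exponential decay of the entropy at rate `4c` per unit PHYSICAL time
         `ε_K t`, uniformly in the cut-off.

* ★★ `uniformLogSobolev_iff_uniformEntropyDecay` — (ULS) ⟺ (UED) (the entropy twin of g18's `uniformL2Gap_tfae`).

PLANNER-FACING, HONEST: an equivalence of two OPEN K-uniform statements; the fixed-K rungs of both hold with the worthless constant
`c_K = (1/2)e^{−4|β'_K|#𝒫_K}/ε_K` (`uniformLogSobolev_fixedCutoff_explicit`).  24809 is ASIDE and NOT restated; nothing K-uniform is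
proved; no crux, rung of the ladder or summit statement is proved; the Yang–Mills mass gap is NOT proved.
-/

set_option autoImplicit false

noncomputable section

namespace Summit.QuantumFields.YangMills.Theorems.ColdStartUniversality

open MeasureTheory ProbabilityTheory
open scoped NNReal ENNReal BigOperators
open Literature.Probability.Process Literature.MathematicalPhysics.QuantumFieldTheory
open Literature.MathematicalPhysics.QuantumLattice (fundamentalRep fundamentalLatticeRep continuous_fundamentalRep)
open Literature.MathematicalPhysics.QuantumFieldTheory.Balaban1983to89

/-- ★★ **(ULS) ⟺ (UED)**: the K-uniform generator-form log-Sobolev inequality in physical units for the Wilson measures `μ_K` at the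
SZZ couplings `β'_K = (γε_K)⁻¹/2` is equivalent to K-uniform exponential decay, at rate `4c` per unit physical time, of the entropy of
every positive `C³` compactly supported cylinder density along every realising Markov kernel family
(`generatorLogSobolev_iff_entropy_decay` at each cut-off with `ρ = c·ε_K`). [cite: BakryGentilLedoux2014, Thm 5.2.1] -/
theorem uniformLogSobolev_iff_uniformEntropyDecay :
    (∃ γ₁ : ℝ, 0 < γ₁ ∧ ∀ (F : T3ContinuumYM3Torus.T3Family) (γ : ℝ), 0 < γ → γ ≤ γ₁ →
      ∃ c : ℝ, 0 < c ∧ ∃ K₀ : ℕ, ∀ K : ℕ, K₀ ≤ K →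
        ∀ (f : (Edge 3 ((F.P K).sitesPerDir 0) × Fin 2 × Fin 2 × Bool → ℝ) → ℝ), ContDiff ℝ 3 f →
        let coords : GaugeConfig 3 ((F.P K).sitesPerDir 0) (Matrix.specialUnitaryGroup (Fin 2) ℂ) →
            (Edge 3 ((F.P K).sitesPerDir 0) × Fin 2 × Fin 2 × Bool → ℝ) :=
          fun V q => (fun z : ℂ => if q.2.2.2 then z.im else z.re)
            ((fundamentalRep (Fin 2) (V q.1) : Matrix (Fin 2) (Fin 2) ℂ) q.2.1 q.2.2.1)
        let gen : GaugeConfig 3 ((F.P K).sitesPerDir 0) (Matrix.specialUnitaryGroup (Fin 2) ℂ) → ℝ := fun V =>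
          (∑ i : Edge 3 ((F.P K).sitesPerDir 0) × Fin 2 × Fin 2 × Bool, fderiv ℝ f (coords V) (Pi.single i 1) *
              (fun z : ℂ => if i.2.2.2 then z.im else z.re)
                ((latticeLangevinDynamics (fundamentalLatticeRep 2) ((γ * (F.P K).eps)⁻¹ / 2)).drift
                  (matrixConfig (fundamentalRep (Fin 2)) V) i.1 i.2.1 i.2.2.1) +
          1 / 2 * ∑ i : Edge 3 ((F.P K).sitesPerDir 0) × Fin 2 × Fin 2 × Bool,
            ∑ j : Edge 3 ((F.P K).sitesPerDir 0) × Fin 2 × Fin 2 × Bool,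
            fderiv ℝ (fun z => fderiv ℝ f z (Pi.single i 1)) (coords V) (Pi.single j 1) *
              ∑ n : Edge 3 ((F.P K).sitesPerDir 0) × NoiseIdx 2,
                (if n.1 = i.1 then (fun z : ℂ => if i.2.2.2 then z.im else z.re)
                  ((latticeLangevinDynamics (fundamentalLatticeRep 2) ((γ * (F.P K).eps)⁻¹ / 2)).noise
                    (matrixConfig (fundamentalRep (Fin 2)) V) i.1 n.2 i.2.1 i.2.2.1) else 0) *
                (if n.1 = j.1 then (fun z : ℂ => if j.2.2.2 then z.im else z.re)
                  ((latticeLangevinDynamics (fundamentalLatticeRep 2) ((γ * (F.P K).eps)⁻¹ / 2)).noise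
                    (matrixConfig (fundamentalRep (Fin 2)) V) j.1 n.2 j.2.1 j.2.2.1) else 0))
        c * (F.P K).eps *
            ((∫ V, f (coords V) ^ 2 * Real.log (f (coords V) ^ 2)
                ∂(wilsonMeasure (d := 3) (L := (F.P K).sitesPerDir 0) (fundamentalRep (Fin 2)) ((γ * (F.P K).eps)⁻¹ / 2))) -
              (∫ V, f (coords V) ^ 2
                ∂(wilsonMeasure (d := 3) (L := (F.P K).sitesPerDir 0) (fundamentalRep (Fin 2)) ((γ * (F.P K).eps)⁻¹ / 2))) *
                Real.log (∫ V, f (coords V) ^ 2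
                  ∂(wilsonMeasure (d := 3) (L := (F.P K).sitesPerDir 0) (fundamentalRep (Fin 2)) ((γ * (F.P K).eps)⁻¹ / 2)))) ≤
          -∫ V, f (coords V) * gen V
            ∂(wilsonMeasure (d := 3) (L := (F.P K).sitesPerDir 0) (fundamentalRep (Fin 2)) ((γ * (F.P K).eps)⁻¹ / 2))) ↔
    (∃ γ₁ : ℝ, 0 < γ₁ ∧ ∀ (F : T3ContinuumYM3Torus.T3Family) (γ : ℝ), 0 < γ → γ ≤ γ₁ →
      ∃ c : ℝ, 0 < c ∧ ∃ K₀ : ℕ, ∀ K : ℕ, K₀ ≤ K →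
      ∀ (κ : ℝ≥0 → Kernel (GaugeConfig 3 ((F.P K).sitesPerDir 0) (Matrix.specialUnitaryGroup (Fin 2) ℂ))
          (GaugeConfig 3 ((F.P K).sitesPerDir 0) (Matrix.specialUnitaryGroup (Fin 2) ℂ))) (_ : ∀ t, IsMarkovKernel (κ t)),
        (∀ (t : ℝ≥0) (x : GaugeConfig 3 ((F.P K).sitesPerDir 0) (Matrix.specialUnitaryGroup (Fin 2) ℂ))
          (Ω : Type) [MeasurableSpace Ω] (P : Measure Ω) [IsProbabilityMeasure P]
          (W : ℝ≥0 → Ω → (Edge 3 ((F.P K).sitesPerDir 0) × NoiseIdx 2 → ℝ)) (hW : IsFlatBrownian W P)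
          (U : ℝ≥0 → Ω → GaugeConfig 3 ((F.P K).sitesPerDir 0) (Matrix.specialUnitaryGroup (Fin 2) ℂ)),
          (∀ ω, U 0 ω = x) →
          (latticeLangevinDynamics (fundamentalLatticeRep 2) ((γ * (F.P K).eps)⁻¹ / 2)).IsSolution (fundamentalRep (Fin 2))
            hW.natFiltration P W U →
          κ t x = P.map (U t)) →
        ∀ (q : (Edge 3 ((F.P K).sitesPerDir 0) × Fin 2 × Fin 2 × Bool → ℝ) → ℝ), ContDiff ℝ 3 q → HasCompactSupport q →
        (∀ x : GaugeConfig 3 ((F.P K).sitesPerDir 0) (Matrix.specialUnitaryGroup (Fin 2) ℂ),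
          0 < q (fun p => (fun z : ℂ => if p.2.2.2 then z.im else z.re)
            ((fundamentalRep (Fin 2) (x p.1) : Matrix (Fin 2) (Fin 2) ℂ) p.2.1 p.2.2.1))) →
        ∀ t : ℝ≥0,
        let Q : GaugeConfig 3 ((F.P K).sitesPerDir 0) (Matrix.specialUnitaryGroup (Fin 2) ℂ) → ℝ := fun x =>
          q (fun p => (fun z : ℂ => if p.2.2.2 then z.im else z.re)
            ((fundamentalRep (Fin 2) (x p.1) : Matrix (Fin 2) (Fin 2) ℂ) p.2.1 p.2.2.1))
        (∫ x, (∫ y, Q y ∂(κ t x)) * Real.log (∫ y, Q y ∂(κ t x))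
            ∂(wilsonMeasure (d := 3) (L := (F.P K).sitesPerDir 0) (fundamentalRep (Fin 2)) ((γ * (F.P K).eps)⁻¹ / 2))) -
            (∫ x, (∫ y, Q y ∂(κ t x))
              ∂(wilsonMeasure (d := 3) (L := (F.P K).sitesPerDir 0) (fundamentalRep (Fin 2)) ((γ * (F.P K).eps)⁻¹ / 2))) *
              Real.log (∫ x, (∫ y, Q y ∂(κ t x))
                ∂(wilsonMeasure (d := 3) (L := (F.P K).sitesPerDir 0) (fundamentalRep (Fin 2)) ((γ * (F.P K).eps)⁻¹ / 2))) ≤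
          Real.exp (-4 * (c * (F.P K).eps) * t) *
            ((∫ x, Q x * Real.log (Q x)
                ∂(wilsonMeasure (d := 3) (L := (F.P K).sitesPerDir 0) (fundamentalRep (Fin 2)) ((γ * (F.P K).eps)⁻¹ / 2))) -
              (∫ x, Q x ∂(wilsonMeasure (d := 3) (L := (F.P K).sitesPerDir 0) (fundamentalRep (Fin 2)) ((γ * (F.P K).eps)⁻¹ / 2))) *
                Real.log (∫ x, Q x
                  ∂(wilsonMeasure (d := 3) (L := (F.P K).sitesPerDir 0) (fundamentalRep (Fin 2)) ((γ * (F.P K).eps)⁻¹ / 2))))) := by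
  constructor
  · rintro ⟨γ₁, hγ₁, h⟩
    refine ⟨γ₁, hγ₁, fun F γ hγ hγ1 => ?_⟩
    obtain ⟨c, hc, K₀, hK⟩ := h F γ hγ hγ1
    refine ⟨c, hc, K₀, fun K hKK κ hκ hreal q hq hqc hpos t => ?_⟩
    have hρ : 0 < c * (F.P K).eps := mul_pos hc (F.P K).eps_pos
    exact (generatorLogSobolev_iff_entropy_decay ((F.P K).sitesPerDir 0) ((γ * (F.P K).eps)⁻¹ / 2) hρ).1
      (hK K hKK) κ hκ hreal q hq hqc hpos t
  · rintro ⟨γ₁, hγ₁, h⟩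
    refine ⟨γ₁, hγ₁, fun F γ hγ hγ1 => ?_⟩
    obtain ⟨c, hc, K₀, hK⟩ := h F γ hγ hγ1
    refine ⟨c, hc, K₀, fun K hKK f hf => ?_⟩
    have hρ : 0 < c * (F.P K).eps := mul_pos hc (F.P K).eps_pos
    exact (generatorLogSobolev_iff_entropy_decay ((F.P K).sitesPerDir 0) ((γ * (F.P K).eps)⁻¹ / 2) hρ).2
      (hK K hKK) f hf

end Summit.QuantumFields.YangMills.Theorems.ColdStartUniversality

end
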